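import Summits.CriticalPhenomena.PercolationContinuityZ3.Theorems.PercNearOneGluingNoHeavyLowerTailIncStarRootEdgeInduction
import Summits.CriticalPhenomena.PercolationContinuityZ3.Theorems.PercNearOneGluingNoHeavyLowerTailIncStarRootTargetStep
import Summits.CriticalPhenomena.PercolationContinuityZ3.Theorems.PercNearOneGluingNoHeavyLowerTailIncStarOfRootUnmarked
import HarnessLib

/-!
# The increasing star: root-edge induction with the STRONG induction hypothesis

Support file for the Sahi programme (`--supports stmt-CriticalPhenomena-4575`, prover prim-sahi-p2 gen 5).  No definitions, no named facts,
no sorries; standard axioms.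

`IncStar.incStar_nonneg_of_rootEdgeBernsteinIH` (gen 4) exposes, at the root edge `e = s(s,v)`, only the two induction hypotheses "increasing
star under `P_{w[e↦0]}` and under `P_{w[e↦1]}` for the SAME marking".  The induction actually runs on the number of fractional non-loop pairs,
so the step may use the increasing star for EVERY weight with strictly fewer fractional non-loop pairs and EVERY marking — in particular for the
cluster-deleted sub-weights `w[e↦0][E(C)↦0]` that a conditional (two-level / Markov-property) treatment of the remaining ROOT–UNMARKED step
needs (memo FROM-prim-sahi-p2-gen5, PROOF-E3 §16).  This file records that strong form:

* `incStar_nonneg_of_rootEdgeBernsteinStrongIH` — the schema with the strong hypothesis (and with the extra datum that `e` is fractional);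
* `incStar_nonneg_of_rootUnmarkedBernsteinStrongIH` — assembly with the PROVED root–target step `IncStar.rootTarget_polar_nonneg`:
  the increasing star on every finite weighted graph follows from Bernstein positivity along fractional ROOT–UNMARKED edges, where the step
  may assume the increasing star for all weights with fewer fractional non-loop pairs and all markings.
-/

noncomputable section

namespace Summit.CriticalPhenomena.PercolationContinuityZ3.Theorems

namespace IncStar

open MeasureTheory Set Literature.Probability.Percolation Literature.Probability.LatticeModels EdgeInduction
open scoped Classical

variable {n : ℕ}

/-- Setting a weight to `0` or `1` at a fractional non-loop pair strictly decreases the number of fractional non-loop pairs. [folklore] -/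
theorem card_fracEdges_update_lt (w : Sym2 (Fin n) → unitInterval) {e : Sym2 (Fin n)} (he : e ∈ fracEdges w) (hnd : ¬ e.IsDiag)
    (u : unitInterval) (hu : u = 0 ∨ u = 1) :
    ((fracEdges (Function.update w e u)).filter fun f => ¬ f.IsDiag).card <
      ((fracEdges w).filter fun f => ¬ f.IsDiag).card := by
  have hmemf : e ∈ (fracEdges w).filter fun f => ¬ f.IsDiag := Finset.mem_filter.2 ⟨he, hnd⟩
  have hsub : ((fracEdges (Function.update w e u)).filter fun f => ¬ f.IsDiag) ⊆
      ((fracEdges w).filter fun f => ¬ f.IsDiag).erase e := by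
    intro f hf
    rw [Finset.mem_filter] at hf
    have hf' := fracEdges_update_subset w e u hu hf.1
    rw [Finset.mem_erase] at hf' ⊢
    exact ⟨hf'.1, Finset.mem_filter.2 ⟨hf'.2, hf.2⟩⟩
  have h1 := Finset.card_le_card hsub
  rw [Finset.card_erase_of_mem hmemf] at h1
  have hpos := Finset.card_pos.2 ⟨_, hmemf⟩
  omega

/-- **ROOT-EDGE INDUCTION SCHEMA, strong induction-hypothesis form.**  If, for every weight `w`, all markings `s b c y` and every vertex `v ≠ s`
with `s(s,v)` fractional, the two mixed Bernstein coefficients of `E₃({s↔b},{s↔c},{s↔y})` along `e = s(s,v)` are nonnegative WHENEVER the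
increasing star holds for every weight with strictly fewer fractional non-loop pairs and every marking (the full induction hypothesis), then the
increasing star holds on every finite weighted graph on `Fin n`. [this work] -/
theorem incStar_nonneg_of_rootEdgeBernsteinStrongIH
    (h : ∀ (w : Sym2 (Fin n) → unitInterval) (s b c y v : Fin n), v ≠ s → s(s, v) ∈ fracEdges w →
      (∀ w' : Sym2 (Fin n) → unitInterval,
          ((fracEdges w').filter fun f => ¬ f.IsDiag).card < ((fracEdges w).filter fun f => ¬ f.IsDiag).card →
          ∀ s' b' c' y' : Fin n, 0 ≤ sahiE3 (prodBernoulli w') (openConn s' b') (openConn s' c') (openConn s' y')) →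
      0 ≤ polar₁ (prodBernoulli (Function.update w s(s, v) 0)) (prodBernoulli (Function.update w s(s, v) 1))
            (openConn s b) (openConn s c) (openConn s y) ∧
        0 ≤ polar₁ (prodBernoulli (Function.update w s(s, v) 1)) (prodBernoulli (Function.update w s(s, v) 0))
            (openConn s b) (openConn s c) (openConn s y)) :
    ∀ (w : Sym2 (Fin n) → unitInterval) (s b c y : Fin n),
      0 ≤ sahiE3 (prodBernoulli w) (openConn s b) (openConn s c) (openConn s y) := by
  suffices H : ∀ (k : ℕ) (w : Sym2 (Fin n) → unitInterval), ((fracEdges w).filter fun e => ¬ e.IsDiag).card ≤ k →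
      ∀ s b c y : Fin n, 0 ≤ sahiE3 (prodBernoulli w) (openConn s b) (openConn s c) (openConn s y) from
    fun w s b c y => H _ w le_rfl s b c y
  intro k
  induction k with
  | zero =>
      intro w hk s b c y
      have hnone : ∀ z v : Fin n, z ≠ v → w s(z, v) = 0 ∨ w s(z, v) = 1 := by
        intro z v hzv
        apply eq_zero_or_one_of_not_mem_fracEdges
        intro hmem
        have : s(z, v) ∈ (fracEdges w).filter fun e => ¬ e.IsDiag := by
          rw [Finset.mem_filter]; exact ⟨hmem, by rwa [Sym2.mk_isDiag_iff]⟩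
        have := Finset.card_pos.2 ⟨_, this⟩
        omega
      refine le_of_eq (sahiE3_hub_eq_zero_of_closed w s ?_ b c y).symm
      intro z v hz hv hzv
      rcases hnone z v hzv with h0 | h1
      · exact h0
      · exact absurd (hz.trans (SimpleGraph.Adj.reachable (by
          rw [SimpleGraph.fromEdgeSet_adj]; exact ⟨h1, hzv⟩))) hv
  | succ k ih =>
      intro w hk s b c y
      set G1 := SimpleGraph.fromEdgeSet {e : Sym2 (Fin n) | w e = 1} with hG1
      by_cases hfr : ∃ z v : Fin n, G1.Reachable s z ∧ z ≠ v ∧ s(z, v) ∈ fracEdges w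
      · obtain ⟨z, v, hsz, hzv, he⟩ := hfr
        rw [sahiE3_hub_eq_of_sureReachable w hsz b c y]
        set e : Sym2 (Fin n) := s(z, v) with hedef
        have hnd : ¬ e.IsDiag := by rw [hedef, Sym2.mk_isDiag_iff]; exact hzv
        have hcard : ∀ (u : unitInterval), u = 0 ∨ u = 1 →
            ((fracEdges (Function.update w e u)).filter fun f => ¬ f.IsDiag).card ≤ k := by
          intro u hu
          have := card_fracEdges_update_lt w he hnd u hu
          omega
        have IH : ∀ w' : Sym2 (Fin n) → unitInterval,
            ((fracEdges w').filter fun f => ¬ f.IsDiag).card < ((fracEdges w).filter fun f => ¬ f.IsDiag).card →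
            ∀ s' b' c' y' : Fin n, 0 ≤ sahiE3 (prodBernoulli w') (openConn s' b') (openConn s' c') (openConn s' y') := by
          intro w' hw' s' b' c' y'
          exact ih w' (by omega) s' b' c' y'
        have i0 := ih _ (hcard 0 (Or.inl rfl)) z b c y
        have i1 := ih _ (hcard 1 (Or.inr rfl)) z b c y
        obtain ⟨b1, b2⟩ := h w z b c y v hzv.symm he IH
        have hp0 : (0 : ℝ) ≤ w e := (w e).2.1
        have hp1 : (w e : ℝ) ≤ 1 := (w e).2.2
        rw [sahiE3_oneBond w e]
        have hq : (0 : ℝ) ≤ 1 - w e := sub_nonneg.2 hp1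
        positivity
      · push Not at hfr
        refine le_of_eq (sahiE3_hub_eq_zero_of_closed w s ?_ b c y).symm
        intro z v hz hv hzv
        rcases eq_zero_or_one_of_not_mem_fracEdges (hfr z v hz hzv) with h0 | h1
        · exact h0
        · exact absurd (hz.trans (SimpleGraph.Adj.reachable (by
            rw [SimpleGraph.fromEdgeSet_adj]; exact ⟨h1, hzv⟩))) hv

/-- **The increasing star from the root–unmarked Bernstein step, strong induction-hypothesis form.**  If for every weight `w`, all markings
`s b c y`, and every vertex `z ∉ {s,b,c,y}` with `s(s,z)` fractional, the two mixed Bernstein coefficients of the increasing star along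
`e = s(s,z)` are nonnegative whenever the increasing star holds for EVERY weight with strictly fewer fractional non-loop pairs and EVERY marking,
then `E₃({s↔b},{s↔c},{s↔y}) ≥ 0` on every finite weighted graph on `Fin n`.  The root–TARGET steps are supplied by
`rootTarget_polar_nonneg`. [this work] -/
theorem incStar_nonneg_of_rootUnmarkedBernsteinStrongIH
    (hRZ : ∀ (w : Sym2 (Fin n) → unitInterval) (s b c y z : Fin n), z ≠ s → z ≠ b → z ≠ c → z ≠ y → s(s, z) ∈ fracEdges w →
      (∀ w' : Sym2 (Fin n) → unitInterval,
          ((fracEdges w').filter fun f => ¬ f.IsDiag).card < ((fracEdges w).filter fun f => ¬ f.IsDiag).card →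
          ∀ s' b' c' y' : Fin n, 0 ≤ sahiE3 (prodBernoulli w') (openConn s' b') (openConn s' c') (openConn s' y')) →
      0 ≤ polar₁ (prodBernoulli (Function.update w s(s, z) 0)) (prodBernoulli (Function.update w s(s, z) 1))
            (openConn s b) (openConn s c) (openConn s y) ∧
        0 ≤ polar₁ (prodBernoulli (Function.update w s(s, z) 1)) (prodBernoulli (Function.update w s(s, z) 0))
            (openConn s b) (openConn s c) (openConn s y)) :
    ∀ (w : Sym2 (Fin n) → unitInterval) (s b c y : Fin n),
      0 ≤ sahiE3 (prodBernoulli w) (openConn s b) (openConn s c) (openConn s y) := by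
  refine incStar_nonneg_of_rootEdgeBernsteinStrongIH ?_
  intro w s b c y v hvs he IH
  have hnd : ¬ (s(s, v) : Sym2 (Fin n)).IsDiag := by rw [Sym2.mk_isDiag_iff]; exact hvs.symm
  -- the same-marking induction hypothesis under `w[e↦0]`, for the root–target certificates
  have h0 : ∀ b' c' y' : Fin n,
      0 ≤ sahiE3 (prodBernoulli (Function.update w s(s, v) 0)) (openConn s b') (openConn s c') (openConn s y') :=
    fun b' c' y' => IH _ (card_fracEdges_update_lt w he hnd 0 (Or.inl rfl)) s b' c' y'
  by_cases hvb : v = b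
  · subst hvb
    exact rootTarget_polar_nonneg w s v c y (Ne.symm hvs) (h0 v c y)
  by_cases hvc : v = c
  · subst hvc
    obtain ⟨p1, p2⟩ := rootTarget_polar_nonneg w s v b y (Ne.symm hvs) (h0 v b y)
    exact ⟨by rwa [polar₁_comm₁₂], by rwa [polar₁_comm₁₂]⟩
  by_cases hvy : v = y
  · subst hvy
    obtain ⟨p1, p2⟩ := rootTarget_polar_nonneg w s v c b (Ne.symm hvs) (h0 v c b)
    refine ⟨?_, ?_⟩
    · rw [polar₁_comm₂₃, polar₁_comm₁₂, polar₁_comm₂₃]; exact p1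
    · rw [polar₁_comm₂₃, polar₁_comm₁₂, polar₁_comm₂₃]; exact p2
  exact hRZ w s b c y v hvs hvb hvc hvy he IH

end IncStar

end Summit.CriticalPhenomena.PercolationContinuityZ3.Theorems
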